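/-
Copyright (c) 2026 the pub-hodgecm-mathlib formalisation cell (harness21).  Prover seat hodgecm-mathlib-K2E5-p16 (g4): Track B «K2-LIT»,
hLiu418 = stmt-HodgeConjecture-24832, LEAD F0P6-plan (g11) LAST DEALS 2026-09-04T05:45:00Z (1) «Φ6b-0 TUBE» (in force under LEAD (g12)) =
ROAD Φ organ Φ6b-0, HEADS file: the Siegel–Gindikin integral of `Herm₂(ℂ)⁺` at a TUBE argument `Y`, `Y + Yᴴ > 0`; 2026-09-04.
-/
import Summits.HodgeConjecture.HodgeConjecture.Theorems.K2LiuHermTwoGammaDefs              -- ★ p857639: `hermTwoGamma`, `hermTwo` + API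
import Summits.HodgeConjecture.HodgeConjecture.Theorems.K2LiuHermTwoSiegelGindikinFibres     -- ★ p857667: fibres + integrability at `y > 0`
import Summits.HodgeConjecture.HodgeConjecture.Theorems.K2LiuHermTwoGammaSiegelGindikin      -- ★ p857689: `integral_siegelGindikin` (`y > 0`)
import Summits.HodgeConjecture.HodgeConjecture.Theorems.K2LiuHermTwoSiegelGindikinTubeFibres -- ★ (this seat): branch facts + tube fibres
import HarnessLib

/-!
# Crux `HLiu418`, ROAD Φ, organ Φ6b-0 «TUBE»: the Siegel–Gindikin integral at a tube argument
# `∫_{x > 0} e^{−tr(x Y)} (det x)^{s−2} dx = Γ₂(s) · (det Y)^{−s}`  for `Y ∈ M₂(ℂ)` with `Y + Yᴴ > 0`, `1 < re s`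

Cell `hodgecm-mathlib`, crux item hLiu418 = `stmt-HodgeConjecture-24832`, route of record `HCCMUnconditional`; squad K2, LEAD F0P6-plan (g11 → g12)
(LAST DEALS 05:45:00Z (1): «NEXT BY NAME = Φ6b-0 TUBE … the same integral at `y + iη`, `η` Hermitian, via ★ `integral_cpow_mul_exp_neg_mul_Ioi_complex`
+ Mathlib's complex-`b` Gaussian = Shimura (1.16) on the tube»), dealer K2E5-plan (g5) (CENSUS-41 row Φ6), prover K2E5-p16 (g4).
THEOREMS ONLY (no `def`, no instance, no notation, no named-fact hypothesis, no `sorry`, default heartbeats); lane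
`--supports stmt-HodgeConjecture-24832 --as helper` (count-neutral helper).

WHAT IS PROVED.  For `Y : Matrix (Fin 2) (Fin 2) ℂ` whose Hermitian part is positive definite (`(Y + Yᴴ).PosDef`; this is the tube
`{y + iη : y > 0, η Hermitian}` = Shimura's right half-space, see `integral_siegelGindikin_add_I_smul`) and `1 < re s`, with `dx` the Lebesgue
measure of the chart `x = hermTwo (a, z, b)` (★ Φ6a):
* `integrableOn_siegelGindikin_tube` — `x ↦ e^{−tr(x Y)} (det x)^{s−2}` is integrable on the cone `Herm₂(ℂ)⁺`;
* `integral_siegelGindikin_tube` — `∫_{x > 0} e^{−tr(x Y)} (det x)^{s−2} dx = Γ₂(s) · (det Y)^{−s}` with the PRINCIPAL power of `det Y`;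
* `integral_siegelGindikin_add_I_smul` — the same for `Y = y + I • η`, `y` positive definite, `η` Hermitian;
* `differentiableOn_integral_siegelGindikin_tube` — holomorphy in `s` on `1 < re s`;
* the BRANCH FACTS that make the principal power the right one on the tube: `re_apply_one_one_pos_of_tube` (`0 < re Y₁₁`),
  `re_conj_mul_det_pos_of_tube` ∕ `re_det_div_pos_of_tube` (`0 < re (det Y / Y₁₁)`: the Schur complement of a matrix with positive definite
  Hermitian part has positive real part, `2 re (v* Y v) = v*(Y + Yᴴ)v > 0` at `v = (Ȳ₁₁, −Y₁₀)`… in coordinates), `det_ne_zero_of_tube`,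
  ★ `Literature.Dynamics.TransferOperators.mul_cpow_of_re_pos` (`(z₁ z₂)^w = z₁^w z₂^w` for `re z₁, re z₂ > 0`) and hence
  `det_cpow_eq_of_tube : (det Y)^w = (Y₁₁)^w · (det Y / Y₁₁)^w` — `det Y` never meets `(−∞, 0]` on the tube.

PROOF (levels 1–3 and the branch facts are the companion file `K2LiuHermTwoSiegelGindikinTubeFibres.lean`; here: domination, assembly, heads).
Coordinates `Y = [[P, W₁],[W₂, Q]]`, `tr(x Y) = aP + zW₂ + z̄W₁ + bQ` (`trace_hermTwo_mul`).  Same Fubini chain as ★ Φ6a with COMPLEX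
parameters: level 1 (`b`, shift `b = |z|²/a + t`) is the complex-`r` Gamma integral ★ `Literature.NumberTheory.LFunctions.AFE.integral_cpow_mul_exp_neg_mul_Ioi_complex`
(`re Q > 0`): `e^{−(aP + zW₂ + z̄W₁ + Q|z|²/a)} a^{s−2} Q^{1−s} Γ(s−1)`; level 2 (`z`) is the Gaussian on `ℂ ≅ ℝ²` (★ `Complex.volume_preserving_equiv_pi`)
with a GENERAL complex linear term, ★ `GaussianFourier.integral_cexp_neg_mul_sum_add` (`ι = Fin 2`, `b = Q/a`, `c = (−(W₁+W₂), I(W₁−W₂))`,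
`Σ cᵢ² = 4W₁W₂`): `(πa/Q) e^{aW₁W₂/Q}`; level 3 (`a`) is the complex-`r` Gamma integral again with `r = S = P − W₁W₂/Q`, `re S > 0`:
`Γ₂(s) Q^{−s} S^{−s} = Γ₂(s)(QS)^{−s} = Γ₂(s)(det Y)^{−s}`.  ABSOLUTE CONVERGENCE is inherited from ★ Φ6a: `‖e^{−tr(xY)}(det x)^{s−2}‖ =
‖e^{−tr(xH)}(det x)^{s−2}‖` for the Hermitian part `H = [[re P, (W₁+W̄₂)/2],[·, re Q]] > 0` (`norm_tube_eq_norm_herm`), so ★ `integrable_indicator_f` ∕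
★ `integrable_fibre_zb` dominate (★ `Integrable.mono'`).  HOLOMORPHY by ★ `DifferentiableOn.congr` with the closed form.

CONSUMER.  Φ6b-1 (Shimura's `ξ(y, h; α, β)` on `Herm₂(ℂ)`: the factor `det(x − iy)^{−β}` is this integral at `Y = 2π(y + ix)`-type tube points).
NOT here: general rank, the Fourier transform in `x`, estimates.
HONEST LABEL.  Count-neutral helper of the K2_Liu road; it pays no socket by itself: `HC_CM` is proved only modulo the 7 printed citations
(2 remaining named inputs: hLiu418 = `stmt-HodgeConjecture-24832`, h413 = `stmt-HodgeConjecture-24833`) until rung 0 closes.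
References (orientation only): [Shimura1982] G. Shimura, Math. Ann. 260 (1982), §1 (1.16) Case II; Faraut–Korányi Thm. VII.1.1 & Prop. VII.1.2.
-/

set_option autoImplicit false
-- the mandated namespace repeats the single-problem summit's segment (`HodgeConjecture.HodgeConjecture`)
set_option linter.dupNamespace false

noncomputable section

open Complex MeasureTheory Set
open scoped ComplexOrder ComplexConjugate

namespace Summit.HodgeConjecture.HodgeConjecture.Cruxes.HLiu418.K2LiuHermTwoSiegelGindikinTube

open Summit.HodgeConjecture.HodgeConjecture.Cruxes.HLiu418.K2LiuHermTwoGammaDefs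
open Summit.HodgeConjecture.HodgeConjecture.Cruxes.HLiu418.K2LiuHermTwoSiegelGindikinFibres
open Summit.HodgeConjecture.HodgeConjecture.Cruxes.HLiu418.K2LiuHermTwoGammaSiegelGindikin
open Summit.HodgeConjecture.HodgeConjecture.Cruxes.HLiu418.K2LiuHermTwoSiegelGindikinTubeFibres

/-! ## The computation in coordinates (complex parameters)

`Y = [[P, W₁],[W₂, Q]]` enters through implicit `P Q W₁ W₂ : ℂ`; the integrand `fY s (a, z, b) = e^{−(aP + zW₂ + z̄W₁ + bQ)} (ab − |z|²)^{s−2}`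
and the cone `D` are section variables with defining equations (no auxiliary `def`). -/

section Coordinates

variable {P Q W₁ W₂ : ℂ}
variable (fY : ℂ → ℝ × ℂ × ℝ → ℂ)
  (hfY : ∀ (s : ℂ) (c : ℝ × ℂ × ℝ), fY s c =
    cexp (-((c.1 : ℂ) * P + c.2.1 * W₂ + conj c.2.1 * W₁ + (c.2.2 : ℂ) * Q)) *
      ((c.1 * c.2.2 - normSq c.2.1 : ℝ) : ℂ) ^ (s - 2))
variable (D : Set (ℝ × ℂ × ℝ)) (hD : D = {c | 0 < c.1 ∧ normSq c.2.1 < c.1 * c.2.2})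

/-! ### The norm of the tube integrand is the norm of the Φ6a integrand of the Hermitian part -/

include hfY in
/-- `‖e^{−tr(xY)} (det x)^{s−2}‖ = ‖e^{−tr(xH)} (det x)^{s−2}‖` with `H` the Hermitian part of `Y`, entrywise in the chart:
`p = re P`, `q = re Q`, `w = (W₁ + conj W₂)/2`. -/
theorem norm_tube_eq_norm_herm (f : ℂ → ℝ × ℂ × ℝ → ℂ)
    (hf : ∀ (s : ℂ) (c : ℝ × ℂ × ℝ), f s c =
      cexp (-((c.1 * P.re + c.2.2 * Q.re + 2 * (c.2.1 * conj ((W₁ + conj W₂) / 2)).re : ℝ) : ℂ)) *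
        ((c.1 * c.2.2 - normSq c.2.1 : ℝ) : ℂ) ^ (s - 2))
    (s : ℂ) (c : ℝ × ℂ × ℝ) : ‖D.indicator (fY s) c‖ = ‖D.indicator (f s) c‖ := by
  by_cases hc : c ∈ D
  · rw [indicator_of_mem hc, indicator_of_mem hc, hfY, hf, norm_mul, norm_mul, Complex.norm_exp, Complex.norm_exp]
    congr 2
    simp only [neg_re, add_re, mul_re, ofReal_re, ofReal_im, zero_mul, sub_zero, conj_re, conj_im]
    simp only [Complex.div_re, Complex.div_im, add_re, add_im, conj_re, conj_im, normSq_apply]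
    norm_num
    ring
  · rw [indicator_of_notMem hc, indicator_of_notMem hc]

/-! ### Integrability (dominated by ★ Φ6a) and the value -/

include hfY hD in
/-- ABSOLUTE CONVERGENCE on the tube: the truncated integrand is integrable on `ℝ × ℂ × ℝ` (`re Q > 0`, Hermitian part in the cone). -/
theorem integrable_indicator_tube (hq : 0 < Q.re) (hpq : normSq ((W₁ + conj W₂) / 2) < P.re * Q.re) {s : ℂ} (hs : 1 < s.re) :
    Integrable (D.indicator (fY s)) ((volume : Measure ℝ).prod (volume : Measure (ℂ × ℝ))) := by
  have hdom := integrable_indicator_f (p := P.re) (q := Q.re) (w := (W₁ + conj W₂) / 2) (fun s c =>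
      cexp (-((c.1 * P.re + c.2.2 * Q.re + 2 * (c.2.1 * conj ((W₁ + conj W₂) / 2)).re : ℝ) : ℂ)) *
        ((c.1 * c.2.2 - normSq c.2.1 : ℝ) : ℂ) ^ (s - 2)) (fun _ _ => rfl) D hD hq hpq hs
  refine hdom.norm.mono' (measurable_indicator_tube fY hfY D hD s).aestronglyMeasurable
    (Filter.Eventually.of_forall fun c => le_of_eq ?_)
  exact norm_tube_eq_norm_herm fY hfY D _ (fun _ _ => rfl) s c

include hfY hD in
/-- For `a > 0` the `(z, b)`-fibre of the truncated tube integrand is integrable on `ℂ × ℝ`. -/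
theorem integrable_tube_fibre_zb (hq : 0 < Q.re) (hpq : normSq ((W₁ + conj W₂) / 2) < P.re * Q.re) {s : ℂ} (hs : 1 < s.re)
    {a : ℝ} (ha : 0 < a) :
    Integrable (fun zb : ℂ × ℝ => D.indicator (fY s) (a, zb)) ((volume : Measure ℂ).prod (volume : Measure ℝ)) := by
  have hp : 0 < P.re := (mul_pos_iff_of_pos_right hq).mp (lt_of_le_of_lt (normSq_nonneg _) hpq)
  have hdom := integrable_fibre_zb (p := P.re) (q := Q.re) (w := (W₁ + conj W₂) / 2) (fun s c =>
      cexp (-((c.1 * P.re + c.2.2 * Q.re + 2 * (c.2.1 * conj ((W₁ + conj W₂) / 2)).re : ℝ) : ℂ)) *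
        ((c.1 * c.2.2 - normSq c.2.1 : ℝ) : ℂ) ^ (s - 2)) (fun _ _ => rfl) D hD hq hs ha
  have hm : Measurable (fun zb : ℂ × ℝ => D.indicator (fY s) (a, zb)) :=
    (measurable_indicator_tube fY hfY D hD s).comp measurable_prodMk_left
  refine hdom.norm.mono' hm.aestronglyMeasurable (Filter.Eventually.of_forall fun zb => le_of_eq ?_)
  exact norm_tube_eq_norm_herm fY hfY D _ (fun _ _ => rfl) s (a, zb)

include hfY hD in
/-- For `a > 0`, the value of the `(z, b)`-fibre on the tube. -/
theorem integral_tube_fibre_zb (hq : 0 < Q.re) (hpq : normSq ((W₁ + conj W₂) / 2) < P.re * Q.re) {s : ℂ} (hs : 1 < s.re)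
    {a : ℝ} (ha : 0 < a) :
    ∫ zb : ℂ × ℝ, D.indicator (fY s) (a, zb) =
      (Real.pi : ℂ) * Complex.Gamma (s - 1) * (1 / Q) ^ (s - 1) * (1 / Q) *
        ((a : ℂ) ^ (s - 1) * cexp (-((P - W₁ * W₂ / Q) * a))) := by
  rw [Measure.volume_eq_prod, integral_prod _ (integrable_tube_fibre_zb fY hfY D hD hq hpq hs ha)]
  have h1 : (fun z : ℂ => ∫ b : ℝ, D.indicator (fY s) (a, (z, b))) =
      fun z => cexp (-((a : ℂ) * P + z * W₂ + conj z * W₁ + ((normSq z / a : ℝ) : ℂ) * Q)) * (a : ℂ) ^ (s - 2) *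
        ((1 / Q) ^ (s - 1) * Complex.Gamma (s - 1)) :=
    funext fun z => integral_tube_fibre_b fY hfY D hD hq hs ha z
  rw [h1]
  exact integral_tube_fibre_z hq s ha

include hfY hD in
/-- THE VALUE in coordinates on the tube: `∫ 1_{x>0} e^{−tr(xY)} (det x)^{s−2} dx = Γ₂(s) · (PQ − W₁W₂)^{−s}` (principal power). -/
theorem integral_indicator_tube (hq : 0 < Q.re) (hpq : normSq ((W₁ + conj W₂) / 2) < P.re * Q.re)
    (hS : 0 < (P - W₁ * W₂ / Q).re) {s : ℂ} (hs : 1 < s.re) :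
    ∫ c : ℝ × ℂ × ℝ, D.indicator (fY s) c = hermTwoGamma s * (P * Q - W₁ * W₂) ^ (-s) := by
  rw [Measure.volume_eq_prod, integral_prod _ (integrable_indicator_tube fY hfY D hD hq hpq hs)]
  have h1 : (fun a : ℝ => ∫ zb : ℂ × ℝ, D.indicator (fY s) (a, zb)) =
      (Ioi (0 : ℝ)).indicator (fun a : ℝ =>
        (Real.pi : ℂ) * Complex.Gamma (s - 1) * (1 / Q) ^ (s - 1) * (1 / Q) *
          ((a : ℂ) ^ (s - 1) * cexp (-((P - W₁ * W₂ / Q) * a)))) := by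
    funext a
    by_cases ha : 0 < a
    · rw [indicator_of_mem (show a ∈ Ioi (0 : ℝ) from ha)]
      exact integral_tube_fibre_zb fY hfY D hD hq hpq hs ha
    · rw [indicator_of_notMem (show a ∉ Ioi (0 : ℝ) from ha)]
      have h0 : (fun zb : ℂ × ℝ => D.indicator (fY s) (a, zb)) = fun _ => 0 := by
        funext zb
        rw [indicator_of_notMem]
        rw [hD]
        exact fun h => ha h.1
      rw [h0, integral_zero]
  rw [h1, integral_indicator measurableSet_Ioi]
  exact integral_tube_fibre_a hq hS hs

end Coordinates

/-! ## The heads: Siegel–Gindikin at a tube argument -/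

/-- **ABSOLUTE CONVERGENCE ON THE TUBE** (organ Φ6b-0): for `Y` with positive definite Hermitian part (`(Y + Yᴴ).PosDef`) and `1 < re s`,
`x ↦ e^{−tr(x Y)} (det x)^{s−2}` is integrable on the cone `Herm₂(ℂ)⁺` (Lebesgue measure of the chart `ℝ × ℂ × ℝ`). -/
theorem integrableOn_siegelGindikin_tube {Y : Matrix (Fin 2) (Fin 2) ℂ} (hY : (Y + Y.conjTranspose).PosDef) {s : ℂ} (hs : 1 < s.re) :
    IntegrableOn (fun c : ℝ × ℂ × ℝ => cexp (-(hermTwo c * Y).trace) * (hermTwo c).det ^ (s - 2))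
      {c : ℝ × ℂ × ℝ | (hermTwo c).PosDef} := by
  have hq := re_apply_one_one_pos_of_tube hY
  have hpq := normSq_hermPart_lt_of_tube hY
  have hDm : MeasurableSet {c : ℝ × ℂ × ℝ | 0 < c.1 ∧ normSq c.2.1 < c.1 * c.2.2} := by
    rw [← setOf_posDef_hermTwo]
    exact measurableSet_posDef_hermTwo
  rw [setOf_posDef_hermTwo, ← integrable_indicator_iff hDm]
  simp_rw [trace_hermTwo_mul, det_hermTwo]
  have h := integrable_indicator_tube (P := Y 0 0) (Q := Y 1 1) (W₁ := Y 0 1) (W₂ := Y 1 0) (fun s c =>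
      cexp (-((c.1 : ℂ) * Y 0 0 + c.2.1 * Y 1 0 + conj c.2.1 * Y 0 1 + (c.2.2 : ℂ) * Y 1 1)) *
        ((c.1 * c.2.2 - normSq c.2.1 : ℝ) : ℂ) ^ (s - 2)) (fun _ _ => rfl)
    {c | 0 < c.1 ∧ normSq c.2.1 < c.1 * c.2.2} rfl hq hpq hs
  rw [← Measure.volume_eq_prod] at h
  exact h

/-- **SIEGEL–GINDIKIN INTEGRAL AT A TUBE ARGUMENT** (organ Φ6b-0; [Shimura1982, (1.16) Case II, m = 2]).  For `Y ∈ M₂(ℂ)` with positive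
definite Hermitian part (`(Y + Yᴴ).PosDef`) and `1 < re s`:
`∫_{x ∈ Herm₂(ℂ)⁺} e^{−tr(x Y)} (det x)^{s−2} dx = Γ₂(s) · (det Y)^{−s}`, the power being the PRINCIPAL one — the right branch, since on the tube
`(det Y)^{−s} = (Y₁₁)^{−s} (det Y / Y₁₁)^{−s}` with both bases in the open right half-plane (`det_cpow_eq_of_tube`). -/
theorem integral_siegelGindikin_tube {Y : Matrix (Fin 2) (Fin 2) ℂ} (hY : (Y + Y.conjTranspose).PosDef) {s : ℂ} (hs : 1 < s.re) :
    ∫ c in {c : ℝ × ℂ × ℝ | (hermTwo c).PosDef},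
        cexp (-(hermTwo c * Y).trace) * (hermTwo c).det ^ (s - 2) = hermTwoGamma s * Y.det ^ (-s) := by
  have hq := re_apply_one_one_pos_of_tube hY
  have hpq := normSq_hermPart_lt_of_tube hY
  have hQ0 : Y 1 1 ≠ 0 := fun h => by simp [h] at hq
  have hS : 0 < (Y 0 0 - Y 0 1 * Y 1 0 / Y 1 1).re := by
    have h := re_det_div_pos_of_tube hY
    rw [Matrix.det_fin_two] at h
    have : (Y 0 0 * Y 1 1 - Y 0 1 * Y 1 0) / Y 1 1 = Y 0 0 - Y 0 1 * Y 1 0 / Y 1 1 := by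
      field_simp
    rw [this] at h
    exact h
  have hDm : MeasurableSet {c : ℝ × ℂ × ℝ | 0 < c.1 ∧ normSq c.2.1 < c.1 * c.2.2} := by
    rw [← setOf_posDef_hermTwo]
    exact measurableSet_posDef_hermTwo
  rw [setOf_posDef_hermTwo, ← integral_indicator hDm, Matrix.det_fin_two]
  simp_rw [trace_hermTwo_mul, det_hermTwo]
  exact integral_indicator_tube (P := Y 0 0) (Q := Y 1 1) (W₁ := Y 0 1) (W₂ := Y 1 0) (fun s c =>
      cexp (-((c.1 : ℂ) * Y 0 0 + c.2.1 * Y 1 0 + conj c.2.1 * Y 0 1 + (c.2.2 : ℂ) * Y 1 1)) *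
        ((c.1 * c.2.2 - normSq c.2.1 : ℝ) : ℂ) ^ (s - 2)) (fun _ _ => rfl)
    {c | 0 < c.1 ∧ normSq c.2.1 < c.1 * c.2.2} rfl hq hpq hS hs

/-- For `y` positive definite and `η` Hermitian, `Y = y + iη` has Hermitian part `2y > 0`: the tube `y + iη` lies in Shimura's right
half-space. -/
theorem posDef_add_conjTranspose_of_add_I_smul {y η : Matrix (Fin 2) (Fin 2) ℂ} (hy : y.PosDef) (hη : η.IsHermitian) :
    ((y + I • η) + (y + I • η).conjTranspose).PosDef := by
  have h : (y + I • η) + (y + I • η).conjTranspose = y + y := by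
    rw [Matrix.conjTranspose_add, Matrix.conjTranspose_smul, hy.1.eq, hη.eq, Complex.star_def, conj_I, neg_smul]
    abel
  rw [h]
  exact hy.add_posSemidef hy.posSemidef

/-- **THE TUBE `y + iη`** (organ Φ6b-0, the form dealt): for `y` positive definite Hermitian, `η` Hermitian and `1 < re s`,
`∫_{x > 0} e^{−tr(x (y + iη))} (det x)^{s−2} dx = Γ₂(s) · det(y + iη)^{−s}` (principal power; `det(y + iη) ∉ (−∞, 0]`). -/
theorem integral_siegelGindikin_add_I_smul {y η : Matrix (Fin 2) (Fin 2) ℂ} (hy : y.PosDef) (hη : η.IsHermitian)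
    {s : ℂ} (hs : 1 < s.re) :
    ∫ c in {c : ℝ × ℂ × ℝ | (hermTwo c).PosDef},
        cexp (-(hermTwo c * (y + I • η)).trace) * (hermTwo c).det ^ (s - 2) =
      hermTwoGamma s * (y + I • η).det ^ (-s) :=
  integral_siegelGindikin_tube (posDef_add_conjTranspose_of_add_I_smul hy hη) hs

/-- Integrability clause of the `y + iη` form. -/
theorem integrableOn_siegelGindikin_add_I_smul {y η : Matrix (Fin 2) (Fin 2) ℂ} (hy : y.PosDef) (hη : η.IsHermitian)
    {s : ℂ} (hs : 1 < s.re) :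
    IntegrableOn (fun c : ℝ × ℂ × ℝ => cexp (-(hermTwo c * (y + I • η)).trace) * (hermTwo c).det ^ (s - 2))
      {c : ℝ × ℂ × ℝ | (hermTwo c).PosDef} :=
  integrableOn_siegelGindikin_tube (posDef_add_conjTranspose_of_add_I_smul hy hη) hs

/-- **HOLOMORPHY ON THE TUBE**: for `Y + Yᴴ > 0` the integral is holomorphic in `s` on `1 < re s` (it agrees there with the holomorphic closed
form `Γ₂(s)(det Y)^{−s}`, `det Y ≠ 0`). -/
theorem differentiableOn_integral_siegelGindikin_tube {Y : Matrix (Fin 2) (Fin 2) ℂ} (hY : (Y + Y.conjTranspose).PosDef) :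
    DifferentiableOn ℂ (fun s : ℂ => ∫ c in {c : ℝ × ℂ × ℝ | (hermTwo c).PosDef},
        cexp (-(hermTwo c * Y).trace) * (hermTwo c).det ^ (s - 2)) {s : ℂ | 1 < s.re} := by
  have hdet : Y.det ≠ 0 := det_ne_zero_of_tube hY
  have hG : DifferentiableOn ℂ (fun s : ℂ => hermTwoGamma s * Y.det ^ (-s)) {s : ℂ | 1 < s.re} := by
    refine differentiableOn_hermTwoGamma.mul ?_
    intro s _
    exact (DifferentiableAt.const_cpow differentiableAt_id.neg (Or.inl hdet)).differentiableWithinAt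
  exact hG.congr fun s hs => integral_siegelGindikin_tube hY hs

end Summit.HodgeConjecture.HodgeConjecture.Cruxes.HLiu418.K2LiuHermTwoSiegelGindikinTube

end
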